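import Summits.AtomisticToContinuum.FouriersLaw.Theses.CageBudgetFekete
import Summits.AtomisticToContinuum.FouriersLaw.Theses.HoelderEscapeProfile
import Summits.AtomisticToContinuum.FouriersLaw.Theorems.HoelderEscapeProfileFibreCalculus
import Summits.AtomisticToContinuum.FouriersLaw.Theorems.CageBudgetFeketeUnboundedHeatVarianceAbelForm
import HarnessLib

/-!
# Stub `stub_abelSandwichTransfer` of line `Sketch` — the Abel infrared sandwich
(crux `CageBudgetFekete.UnboundedHeatVariance`, item stmt-AtomisticToContinuum-15771; `--supports` file)

WHAT. The registered transfer stub S_T of the skeleton `Cruxes/UnboundedHeatVariance/Lines/Sketch.lean`: given the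
Chebyshev comparison on the circle S_A (`Σ_x (1 − cos kx)Δ(x) ≤ (1 − cos k)·Σ_x x²Δ⁺(x)`, a HYPOTHESIS here), in the
crux's arena the RELATIVE NEGATIVE SPREAD (P) and the INFRARED NON-FREEZING (IR) of the Abel energy profile
`S̄_ν(x) = ν∫₀^∞ e^{-νt} S(x,t) dt` imply the Abel divergence `ν⁻¹∫_{t>0} e^{-νt} C(t) dt → +∞` as `ν ↓ 0`.

HOW (plumbing over LANDED calculus). The twelve-clause fibre calculus
`Theorems.FibreCalculusSketch.fibreCalculus_proof : Theses.HoelderEscapeProfile.FibreCalculus` supplies the weighted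
summabilities `Σ(1+x²)|S̄_ν| < ∞`, `Σ(1+x²)|S(·,0)| < ∞`, the conservation law `Σ_x S̄_ν(x) = χ(0) = Σ_x S(x,0)` and the
Helfand–Abel identity `∫₀^∞e^{-νt}C = (ν/2)(Σ x²S̄_ν − Σ x²S(·,0))`. With the displacement kernel `Δ = S̄_ν − S(·,0)`
(`Σ Δ = 0`): `Σ(1 − cos kx)Δ = χ(k) − f̂_ν(k)`, so S_A and IR give `(1 − cos k)·P_ν ≥ 2M(1 − cos k)`, i.e. `P_ν ≥ 2M`
for the positive second moment `P_ν = Σ x²Δ⁺`; P caps the negative one, `N_ν ≤ θP_ν + K`, whence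
`ν⁻¹A(ν) = ½(P_ν − N_ν) ≥ (1 − θ)M − K/2` at ONE small `ν`. The landed Bochner representation
(`Birth.stub_currentSpectralMeasure`) makes `ν ↦ ν⁻¹A(ν) = ∫(ν²+ω²)⁻¹dρ` antitone
(`Birth.inv_mul_abel_eq_integral_inv_sq_add`, `Birth.integral_inv_sq_add_antitone`), which upgrades "large at one
small `ν`" to `Tendsto … (𝓝[>] 0) atTop`.

No definitions; pure real analysis helper lemmas on weighted-summable sequences `ℤ → ℝ` first, then the stub.
prover-line-stmt-AtomisticToContinuum-15771-c1-0, 2026-08-17.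
-/

noncomputable section

namespace Summit.AtomisticToContinuum.FouriersLaw.Theorems.UnboundedHeatVariance.Sketch

open MeasureTheory Set Filter Topology
open Literature.MathematicalPhysics.KineticTheory.HeatConduction
open Summit.AtomisticToContinuum.FouriersLaw.Theses

/-! ### 1. Weighted-summable sequences on `ℤ` -/

/-- `|c x| ≤ (1 + x²)|c x|`. [folklore] -/
theorem abs_le_weight_mul_abs (c : ℤ → ℝ) (x : ℤ) : |c x| ≤ (1 + (x : ℝ) ^ 2) * |c x| :=
  le_mul_of_one_le_left (abs_nonneg _) (by nlinarith [sq_nonneg (x : ℝ)])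

/-- A sequence with `Σ(1+x²)|c x| < ∞` is summable. [folklore] -/
theorem summable_of_weighted {c : ℤ → ℝ} (hc : Summable (fun x : ℤ => (1 + (x : ℝ) ^ 2) * |c x|)) :
    Summable c :=
  hc.of_norm_bounded fun x => by
    rw [Real.norm_eq_abs]
    exact abs_le_weight_mul_abs c x

/-- A sequence with `Σ(1+x²)|c x| < ∞` has a summable cosine series at every wavenumber. [folklore] -/
theorem summable_cos_mul_of_weighted {c : ℤ → ℝ}
    (hc : Summable (fun x : ℤ => (1 + (x : ℝ) ^ 2) * |c x|)) (k : ℝ) :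
    Summable (fun x : ℤ => Real.cos (k * (x : ℝ)) * c x) :=
  hc.of_norm_bounded fun x => by
    rw [Real.norm_eq_abs, abs_mul]
    exact (mul_le_of_le_one_left (abs_nonneg _) (Real.abs_cos_le_one _)).trans
      (abs_le_weight_mul_abs c x)

/-- A sequence with `Σ(1+x²)|c x| < ∞` has a finite second moment `Σ x² c x`. [folklore] -/
theorem summable_sq_mul_of_weighted {c : ℤ → ℝ}
    (hc : Summable (fun x : ℤ => (1 + (x : ℝ) ^ 2) * |c x|)) :
    Summable (fun x : ℤ => (x : ℝ) ^ 2 * c x) :=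
  hc.of_norm_bounded fun x => by
    rw [Real.norm_eq_abs, abs_mul, abs_of_nonneg (sq_nonneg (x : ℝ))]
    nlinarith [sq_nonneg (x : ℝ), abs_nonneg (c x)]

/-- A sequence with `Σ(1+x²)|c x| < ∞` has a finite positive second moment `Σ x² max(c x, 0)`. [folklore] -/
theorem summable_sq_mul_posPart_of_weighted {c : ℤ → ℝ}
    (hc : Summable (fun x : ℤ => (1 + (x : ℝ) ^ 2) * |c x|)) :
    Summable (fun x : ℤ => (x : ℝ) ^ 2 * max (c x) 0) := by
  refine Summable.of_nonneg_of_le (fun x => by positivity) (fun x => ?_) hc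
  have h1 : max (c x) 0 ≤ |c x| := max_le (le_abs_self _) (abs_nonneg _)
  have h2 : 0 ≤ max (c x) 0 := le_max_right _ _
  nlinarith [sq_nonneg (x : ℝ), abs_nonneg (c x)]

/-- Weighted summability passes to differences. [folklore] -/
theorem weighted_summable_sub {a b : ℤ → ℝ}
    (ha : Summable (fun x : ℤ => (1 + (x : ℝ) ^ 2) * |a x|))
    (hb : Summable (fun x : ℤ => (1 + (x : ℝ) ^ 2) * |b x|)) :
    Summable (fun x : ℤ => (1 + (x : ℝ) ^ 2) * |a x - b x|) := by
  refine Summable.of_nonneg_of_le (fun x => by positivity) (fun x => ?_) (ha.add hb)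
  have h1 : |a x - b x| ≤ |a x| + |b x| := abs_sub (a x) (b x)
  have h2 : 0 ≤ 1 + (x : ℝ) ^ 2 := by positivity
  nlinarith

/-- `max(a − b, 0) − max(b − a, 0) = a − b`. [folklore] -/
theorem posPart_sub_posPart_swap (a b : ℝ) : max (a - b) 0 - max (b - a) 0 = a - b := by
  rcases le_total a b with h | h
  · rw [max_eq_right (by linarith), max_eq_left (by linarith)]
    ring
  · rw [max_eq_left (by linarith), max_eq_right (by linarith)]
    ring

/-- **Second-moment split.** For weighted-summable `a, b`:
`Σ x² a − Σ x² b = Σ x²(a − b)⁺ − Σ x²(b − a)⁺` (positive minus negative second moment of the displacement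
`a − b`). [folklore] -/
theorem tsum_sq_mul_sub_eq_posSpread_sub_negSpread {a b : ℤ → ℝ}
    (ha : Summable (fun x : ℤ => (1 + (x : ℝ) ^ 2) * |a x|))
    (hb : Summable (fun x : ℤ => (1 + (x : ℝ) ^ 2) * |b x|)) :
    (∑' x : ℤ, (x : ℝ) ^ 2 * a x) - ∑' x : ℤ, (x : ℝ) ^ 2 * b x =
      (∑' x : ℤ, (x : ℝ) ^ 2 * max (a x - b x) 0) - ∑' x : ℤ, (x : ℝ) ^ 2 * max (b x - a x) 0 := by
  rw [← (summable_sq_mul_of_weighted ha).tsum_sub (summable_sq_mul_of_weighted hb),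
    ← (summable_sq_mul_posPart_of_weighted (weighted_summable_sub ha hb)).tsum_sub
      (summable_sq_mul_posPart_of_weighted (weighted_summable_sub hb ha))]
  refine tsum_congr fun x => ?_
  rw [← mul_sub, ← mul_sub, posPart_sub_posPart_swap]

/-- **The displacement kernel seen through `1 − cos(kx)`.** For weighted-summable `a, b` with equal sums
(conservation), `Σ (1 − cos kx)(a − b)(x) = Σ cos(kx) b(x) − Σ cos(kx) a(x)`. [folklore] -/
theorem tsum_one_sub_cos_mul_sub {a b : ℤ → ℝ}
    (ha : Summable (fun x : ℤ => (1 + (x : ℝ) ^ 2) * |a x|))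
    (hb : Summable (fun x : ℤ => (1 + (x : ℝ) ^ 2) * |b x|))
    (hcons : ∑' x : ℤ, a x = ∑' x : ℤ, b x) (k : ℝ) :
    ∑' x : ℤ, (1 - Real.cos (k * (x : ℝ))) * (a x - b x) =
      (∑' x : ℤ, Real.cos (k * (x : ℝ)) * b x) - ∑' x : ℤ, Real.cos (k * (x : ℝ)) * a x := by
  have hΔ := weighted_summable_sub ha hb
  have e1 : ∀ x : ℤ, (1 - Real.cos (k * (x : ℝ))) * (a x - b x) =
      (a x - b x) - Real.cos (k * (x : ℝ)) * (a x - b x) := fun x => by ring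
  rw [tsum_congr e1, (summable_of_weighted hΔ).tsum_sub (summable_cos_mul_of_weighted hΔ k),
    (summable_of_weighted ha).tsum_sub (summable_of_weighted hb), hcons, sub_self, zero_sub]
  have e2 : ∀ x : ℤ, Real.cos (k * (x : ℝ)) * (a x - b x) =
      Real.cos (k * (x : ℝ)) * a x - Real.cos (k * (x : ℝ)) * b x := fun x => mul_sub _ _ _
  rw [tsum_congr e2, (summable_cos_mul_of_weighted ha k).tsum_sub (summable_cos_mul_of_weighted hb k)]
  ring

/-- **The sandwich.** Chebyshev comparison (hypothesis `hSA`) + conservation + an infrared deficit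
`M(2 − 2cos k) ≤ Σcos(kx)b − Σcos(kx)a` at a wavenumber with `cos k ≠ 1` force the positive second moment of the
displacement: `2M ≤ Σ x²(a − b)⁺`. [folklore] -/
theorem two_mul_le_posSpread
    (hSA : ∀ Δ : ℤ → ℝ, Summable (fun x : ℤ => (1 + (x : ℝ) ^ 2) * |Δ x|) → ∀ k : ℝ, Real.cos k ≠ 1 →
      ∑' x : ℤ, (1 - Real.cos (k * (x : ℝ))) * Δ x ≤ (1 - Real.cos k) * ∑' x : ℤ, (x : ℝ) ^ 2 * max (Δ x) 0)
    {a b : ℤ → ℝ}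
    (ha : Summable (fun x : ℤ => (1 + (x : ℝ) ^ 2) * |a x|))
    (hb : Summable (fun x : ℤ => (1 + (x : ℝ) ^ 2) * |b x|))
    (hcons : ∑' x : ℤ, a x = ∑' x : ℤ, b x) {k M : ℝ} (hk : Real.cos k ≠ 1)
    (hM : M * (2 - 2 * Real.cos k) ≤
      (∑' x : ℤ, Real.cos (k * (x : ℝ)) * b x) - ∑' x : ℤ, Real.cos (k * (x : ℝ)) * a x) :
    2 * M ≤ ∑' x : ℤ, (x : ℝ) ^ 2 * max (a x - b x) 0 := by
  have hcheb := hSA (fun x => a x - b x) (weighted_summable_sub ha hb) k hk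
  have hid := tsum_one_sub_cos_mul_sub ha hb hcons k
  rw [hid] at hcheb
  have hpos : 0 < 1 - Real.cos k := by
    have := Real.cos_le_one k
    exact sub_pos.2 (lt_of_le_of_ne this hk)
  have h1 : (1 - Real.cos k) * (2 * M) ≤ (1 - Real.cos k) * ∑' x : ℤ, (x : ℝ) ^ 2 * max (a x - b x) 0 := by
    nlinarith
  exact le_of_mul_le_mul_left h1 hpos

/-- **From one small `ν` to the limit.** If `ν ↦ F ν` agrees on `ν > 0` with the Poisson integrals
`∫(ν²+ω²)⁻¹dρ` of a finite measure `ρ`, and for every level `R` there is some `ν > 0` with `R ≤ F ν`, then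
`F → +∞` along `𝓝[>] 0`: the Poisson integrals are antitone in `ν` (`Birth.integral_inv_sq_add_antitone`).
[folklore] -/
theorem tendsto_atTop_of_poisson (ρ : Measure ℝ) [IsFiniteMeasure ρ] (F : ℝ → ℝ)
    (hF : ∀ ν : ℝ, 0 < ν → F ν = ∫ w, (ν ^ 2 + w ^ 2)⁻¹ ∂ρ)
    (hlarge : ∀ R : ℝ, ∃ ν : ℝ, 0 < ν ∧ R ≤ F ν) :
    Tendsto F (𝓝[>] 0) atTop := by
  rw [tendsto_atTop]
  intro R
  obtain ⟨ν, hν, hR⟩ := hlarge R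
  have hmem : Ioo (0:ℝ) ν ∈ 𝓝[>] (0:ℝ) := Ioo_mem_nhdsGT hν
  filter_upwards [hmem] with ν' hν'
  rw [hF ν' hν'.1]
  rw [hF ν hν] at hR
  exact hR.trans (Birth.integral_inv_sq_add_antitone ρ hν'.1 hν'.2.le)

/-! ### 2. The stub -/

/-- **S_T — `stub_abelSandwichTransfer` (registered signature, verbatim): the Abel infrared sandwich.** Given the
Chebyshev comparison S_A, in the arena of `CageBudgetFekete.UnboundedHeatVariance` the relative negative spread (P)
and the infrared non-freezing (IR) of the Abel energy profile imply `ν⁻¹∫_{t>0}e^{-νt}C(t)dt → +∞` as `ν ↓ 0`: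
fibre calculus (`FibreCalculusSketch.fibreCalculus_proof`: weighted summability, conservation, Helfand–Abel),
`two_mul_le_posSpread`, `tsum_sq_mul_sub_eq_posSpread_sub_negSpread`, and antitonicity of the Poisson integrals of the
spectral measure (`Birth.stub_currentSpectralMeasure`, `Birth.inv_mul_abel_eq_integral_inv_sq_add`,
`Birth.integral_inv_sq_add_antitone`). [folklore] -/
theorem stub_abelSandwichTransfer :
    (∀ Δ : ℤ → ℝ, Summable (fun x : ℤ => (1 + (x : ℝ) ^ 2) * |Δ x|) → ∀ k : ℝ, Real.cos k ≠ 1 → ∑' x : ℤ, (1 - Real.cos (k * (x : ℝ))) * Δ x ≤ (1 - Real.cos k) * ∑' x : ℤ, (x : ℝ) ^ 2 * max (Δ x) 0) → ∀ ω₂ lam β γ : ℝ, 0 < ω₂ → 0 < lam → 0 < β → ∀ T : ℝ, 0 < T → ∀ μ : MeasureTheory.Measure Literature.MathematicalPhysics.KineticTheory.HeatConduction.ChainConfig, (Literature.MathematicalPhysics.KineticTheory.HeatConduction.pinnedChain ω₂ lam β γ).IsChainGibbsMeasure T μ → Literature.MathematicalPhysics.KineticTheory.HeatConduction.IsShiftInvariant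 μ → μ.map (fun σ : Literature.MathematicalPhysics.KineticTheory.HeatConduction.ChainConfig => fun x : ℤ => ((σ x).1, -(σ x).2)) = μ → ∀ D : Literature.MathematicalPhysics.KineticTheory.HeatConduction.InfiniteChainDynamics (Literature.MathematicalPhysics.KineticTheory.HeatConduction.pinnedChain ω₂ lam β γ), D.PreservesMeasure μ → (∀ t : ℝ, ∀ᵐ σ ∂μ, D.flow t (Literature.MathematicalPhysics.KineticTheory.HeatConduction.shift σ) = Literature.MathematicalPhysics.KineticTheory.HeatConduction.shift (D.flow t σ)) → (∀ t : ℝ, D.HasAbsConvergentCorrelation μ t) → Continuous (fun t : ℝ => D.currentCorrelation μ t) → ∀ h : Literature.MathematicalPhysics.KineticTheory.HeatConduction.ChainConfig → ℤ → ℝ, h = (fun (σ : Literature.MathematicalPhysics.KineticTheory.HeatConduction.ChainConfig) (x : ℤ) => (σ x).2 ^ 2 / 2 + (Literature.MathematicalPhysics.KineticTheory.HeatConduction.pinnedChain ω₂ lam β γ).U (σ x).1 + ((Literature.MathematicalPhysics.KineticTheory.HeatConduction.pinnedChain ω₂ lam β γ).V ((σ (x + 1)).1 - (σ x).1) + (Literature.MathematicalPhysics.KineticTheory.HeatConduction.pinnedChain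 ω₂ lam β γ).V ((σ x).1 - (σ (x - 1)).1)) / 2) → ∀ S : ℤ → ℝ → ℝ, S = (fun (x : ℤ) (t : ℝ) => ∫ σ, (h σ 0 - ∫ σ', h σ' 0 ∂μ) * (h (D.flow t σ) x - ∫ σ', h σ' 0 ∂μ) ∂μ) → ∀ Sb : ℝ → ℤ → ℝ, Sb = (fun (ν : ℝ) (x : ℤ) => ν * ∫ t in Set.Ioi (0:ℝ), Real.exp (-(ν * t)) * S x t) → ∀ fh : ℝ → ℝ → ℝ, fh = (fun (ν k : ℝ) => ∑' x : ℤ, Real.cos (k * (x : ℝ)) * Sb ν x) → ∀ χk : ℝ → ℝ, χk = (fun k : ℝ => ∑' x : ℤ, Real.cos (k * (x : ℝ)) * S x 0) → (∃ θ K ν₀ : ℝ, θ < 1 ∧ 0 < ν₀ ∧ ∀ ν : ℝ, 0 < ν → ν < ν₀ → ∑' x : ℤ, (x : ℝ) ^ 2 * max (S x 0 - Sb ν x) 0 ≤ θ * (∑' x : ℤ, (x : ℝ) ^ 2 * max (Sb ν x - S x 0) 0) + K) → (∀ M ν₁ : ℝ, 0 < ν₁ → ∃ k : ℝ, Real.cos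 k ≠ 1 ∧ ∃ ν : ℝ, 0 < ν ∧ ν < ν₁ ∧ M * (2 - 2 * Real.cos k) ≤ χk k - fh ν k) → Filter.Tendsto (fun ν : ℝ => ν⁻¹ * ∫ t in Set.Ioi (0:ℝ), Real.exp (-(ν * t)) * D.currentCorrelation μ t) (nhdsWithin (0:ℝ) (Set.Ioi 0)) Filter.atTop := by
  intro hSA ω₂ lam β γ hω hl hβ T hT μ hG hSI hRefl D hP hShift hAC hCc h hh S hS Sb hSb fh hfh χk hχk hPst hIR
  obtain ⟨θ, K, ν₀, hθ, hν₀, hPst⟩ := hPst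
  obtain ⟨-, -, -, h4, h5, -, h7, -, -, -, -, h12⟩ :=
    Summit.AtomisticToContinuum.FouriersLaw.Theorems.FibreCalculusSketch.fibreCalculus_proof ω₂ lam β γ hω hl hβ T
      hT μ hG hSI hRefl D hP hShift h hh S hS Sb hSb _ rfl _ rfl fh hfh χk hχk
  obtain ⟨ρ, hfin, hrep⟩ :=
    Birth.stub_currentSpectralMeasure ω₂ lam β γ hω hl hβ T hT μ hG hSI hRefl D hP hShift hAC hCc
  haveI := hfin
  -- conservation in the form `Σ S̄_ν = Σ S(·,0)`
  have hχ0 : χk 0 = ∑' x : ℤ, S x 0 := by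
    rw [hχk]
    simp only [zero_mul, Real.cos_zero, one_mul]
  have hcons : ∀ ν : ℝ, 0 < ν → ∑' x : ℤ, Sb ν x = ∑' x : ℤ, S x 0 := fun ν hν => (h7 ν hν).trans hχ0
  refine tendsto_atTop_of_poisson ρ _
    (fun ν hν => Birth.inv_mul_abel_eq_integral_inv_sq_add (fun t => D.currentCorrelation μ t) ρ hrep hν)
    (fun R => ?_)
  -- one small `ν` beating `R`
  have h1θ : 0 < 1 - θ := sub_pos.2 hθ
  set M : ℝ := (|R| + |K| / 2 + 1) / (1 - θ) with hM
  have hMθ : M * (1 - θ) = |R| + |K| / 2 + 1 := by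
    rw [hM]
    field_simp
  obtain ⟨k, hk, ν, hν, hνν₀, hMk⟩ := hIR M ν₀ hν₀
  refine ⟨ν, hν, ?_⟩
  have hMk' : M * (2 - 2 * Real.cos k) ≤
      (∑' x : ℤ, Real.cos (k * (x : ℝ)) * S x 0) - ∑' x : ℤ, Real.cos (k * (x : ℝ)) * Sb ν x := by
    simpa only [hfh, hχk] using hMk
  have hP2 : 2 * M ≤ ∑' x : ℤ, (x : ℝ) ^ 2 * max (Sb ν x - S x 0) 0 :=
    two_mul_le_posSpread hSA (h4 ν hν) h5 (hcons ν hν) hk hMk'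
  have hN := hPst ν hν hνν₀
  have hHelf : ν⁻¹ * ∫ t in Set.Ioi (0:ℝ), Real.exp (-(ν * t)) * D.currentCorrelation μ t =
      1 / 2 * ((∑' x : ℤ, (x : ℝ) ^ 2 * max (Sb ν x - S x 0) 0) -
        ∑' x : ℤ, (x : ℝ) ^ 2 * max (S x 0 - Sb ν x) 0) := by
    rw [h12 ν hν, ← tsum_sq_mul_sub_eq_posSpread_sub_negSpread (h4 ν hν) h5, ← mul_assoc]
    congr 1
    rw [div_eq_mul_inv, ← mul_assoc, inv_mul_cancel₀ hν.ne', one_mul, one_div]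
  rw [hHelf]
  have hmul : (1 - θ) * (2 * M) ≤ (1 - θ) * ∑' x : ℤ, (x : ℝ) ^ 2 * max (Sb ν x - S x 0) 0 :=
    mul_le_mul_of_nonneg_left hP2 h1θ.le
  linarith [le_abs_self R, le_abs_self K]

end Summit.AtomisticToContinuum.FouriersLaw.Theorems.UnboundedHeatVariance.Sketch

end
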